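import Mathlib
import HarnessLib
import Literature.Probability.MarkovChains.RelaxationTimeVarianceDecay
import Literature.Probability.MarkovChains.SpectralGapVariational

/-!
# The second eigenfunction of a monotone reversible chain (Levin–Peres–Wilmer §22.5: Lemma 22.17, Lemma 22.18)

HONEST FRAMING: exact (Metropolis-corrected) sampling algorithms for lattice gauge theory; figures
of merit are autocorrelation/cost numbers at stated couplings and volumes; no continuum-physics claim.

Topic `Probability/MarkovChains`; namespace `Literature.Probability.MarkovChains`.  Vocabulary of
`PeskunOrdering.lean` (`piInner π g h = ⟨g,h⟩_π`, `DetailedBalance`, `IsIrreducible`),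
`TotalVariation.lean` (`IsRowStochastic`), `SpectralGapVariational.lean` (`orthEigenvalues π P`,
`secondEigenvalue π P = λ₂` = the largest eigenvalue of `P` carried by an eigenfunction `⊥_π 1`,
`spectralGap π P = γ = 1 − λ₂`, Lemma 13.7 and `exists_eigenfunction_spectralGap`) and
`SpectralRepresentation.lean` (Lemma 12.2: the `π`-orthonormal eigenbasis `specFun hA j = f_j`,
`specVal hA j = λ_j` of a reversible `P`) with the expansion `f = Σ_j ⟨f,f_j⟩_π f_j` REUSED from
`RelaxationTimeVarianceDecay.lean` (`sum_piInner_specFun_mul`, eq. (12.4)).  Finite state space `X`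
carrying a partial order `≤`; "increasing" = `Monotone`; a chain is MONOTONE when `Pf` is increasing for every increasing `f`
(Proposition 22.7 (ii), the form in which `StochasticDomination.lean`'s `IsMonotoneChain` unfolds).
Source: D. A. Levin, Y. Peres (with E. L. Wilmer), *Markov Chains and Mixing Times*, 2nd ed., AMS 2017
[LevinPeres2017], §22.5 "The Second Eigenfunction", pp. 313–314.  EVERYTHING IS PROVED (0 named facts).

* **LEMMA 22.17** `LevinPeres2017_lemma_22_17` — for a reversible monotone chain `P` (positive
  reversible probability vector `π`, `|X| ≥ 2`) **the second eigenvalue `λ₂` has an increasing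
  eigenfunction**: some increasing `f ≢ 0` with `E_π f = 0` has `Pf = λ₂ f`
  [cite: LevinPeres2017, §22.5 Lemma 22.17].  PROOF AS PRINTED, with two repairs declared here:
  (Claim) an increasing `f` with `E_π(f) = 0` and `⟨f, f₂⟩_π ≠ 0` exists — typed as
  `exists_monotone_piInner_ne_zero`, obtained from the two up-set indicators `1{· ≥ x₀} − 1{· > x₀} = 1{x₀}`
  instead of the book's linear extension (Exercise 22.3), which gives the same conclusion; then
  `f = Σ_j a_j f_j` in the orthonormal eigenbasis and the power iteration.  The book iterates
  `P^{2t}f/λ₂^{2t} → f₂`, which needs `|λ_j| < |λ₂|` for the other components; the iteration typed here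
  is `(P + 2I)^t f/(λ₂ + 2)^t`, whose ratios `(λ_j + 2)/(λ₂ + 2)` lie in `[0,1)` for every component
  `λ_j < λ₂` of `f` (all eigenvalues are `≥ −1`, and every eigenfunction component of the mean-zero `f`
  has `λ_j ≤ λ_2`), and `(P + 2I)` preserves increasing functions exactly as `P` does; the limit is the
  projection of `f` on the `λ₂`-eigenspace, increasing as a pointwise limit of increasing functions and
  non-zero because its inner product with `f₂` is `⟨f, f₂⟩_π ≠ 0`.  With a multiple eigenvalue `λ₂` the
  limit is an element of the eigenspace (not necessarily the basis vector `f₂`), which is all the lemma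
  asserts.  No irreducibility is assumed (if `1` happens to be an eigenvalue on `1^⊥`, i.e. `λ₂ = 1`,
  the centred limit is used).
* `piInner_eq_zero_of_eigen_ne` — eigenfunctions of a reversible `P` with distinct eigenvalues are
  `π`-orthogonal [cite: LevinPeres2017, §12.1 Lemma 12.2 (i) (self-adjointness of `P` on `ℓ²(π)`);
  §22.5 proof of Lemma 22.18 ("Thus `E_π(fg) > 0`, so `f` and `g` correspond to the same eigenvalue")];
  `eigenvalue_nonneg_of_monotone` — an increasing eigenfunction that separates one comparable pair has
  eigenvalue `λ ≥ 0` [cite: LevinPeres2017, §22.5 proof of Lemma 22.18 ("Since `P` is monotone,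
  `Pf = λf` is weakly increasing, so `λ ≥ 0`")].
* **LEMMA 22.18** `LevinPeres2017_lemma_22_18` — for a reversible monotone chain whose stationary
  law `π` has POSITIVE CORRELATIONS (`E_π(φψ) ≥ E_π(φ)E_π(ψ)` for increasing `φ, ψ`, eq. (22.4)),
  **a strictly increasing eigenfunction `f`, `Pf = λf`, has `λ = λ₂`**
  [cite: LevinPeres2017, §22.5 Lemma 22.18].  DECLARED DEVIATION: the book's hypothesis is "`x` and
  `y` are comparable if `P(x,y) > 0`", used only to invoke Theorem 22.16 (`π` then has positive
  correlations); the positive-correlations property itself is taken as the hypothesis here, so that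
  the lemma applies verbatim once Theorem 22.16 — or, for the Ising Gibbs law, the FKG inequality
  (`Literature/Probability/LatticeModels/IsingFKG.lean`) — supplies it.  Proof as printed: with the
  increasing `λ₂`-eigenfunction `g` of Lemma 22.17, `f − εg` is increasing for a small `ε > 0`
  (finitely many comparable pairs), positive correlations give `E_π(fg) ≥ ε E_π(g²) > 0`, and
  orthogonality forces `λ = λ₂` (the book's remark `E_π(f) = 0` is not needed).
* USE (Example 22.19, [cite: LevinPeres2017, §22.5 Example 22.19]): for the Glauber dynamics of the
  ferromagnetic Ising model on the `n`-cycle the magnetisation `Σ_k σ(k)` is a strictly increasing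
  eigenfunction (`IsingCycleEigenfunction.lean`, eq. (15.17)), so Lemma 22.18 identifies its eigenvalue
  `1 − (1 − tanh 2β)/n` with `λ₂` — the equality case of that file's `LevinPeres2017_thm_15_5_gap_le`;
  the instance is left to a sibling file (it needs the monotonicity and FKG inputs in the
  `gibbsLaw`/`glauberSiteLaw` vocabulary: `IsingGlauberMonotone.lean`).

Context (cell pub-lqcd, venture LatticeQCDFlow): "guess the slowest mode" — for monotone (heat-bath
type) dynamics an increasing trial observable that happens to be an eigenfunction IS the slowest
mode, so its autocorrelation time is the relaxation time; this is the tool behind reading `t_rel` off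
the magnetisation for single-site heat-bath updates.
-/

namespace Literature.Probability.MarkovChains

open Finset Matrix Filter Topology

variable {X : Type*} [Fintype X] [DecidableEq X]

/-! ## Plumbing: the inner product, eigenpairs, the eigenbasis expansion -/

section Plumbing

variable {π : X → ℝ} {P : Matrix X X ℝ}

omit [DecidableEq X] in
/-- `(M v)_x = Σ_y M x y v_y`. [folklore] -/
private theorem mulVec_apply₄ (M : Matrix X X ℝ) (v : X → ℝ) (x : X) :
    (M *ᵥ v) x = ∑ y, M x y * v y := rfl

omit [DecidableEq X] in
/-- `⟨c•g, h⟩_π = c⟨g,h⟩_π`. [folklore] -/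
private theorem piInner_smul_left (π : X → ℝ) (c : ℝ) (g h : X → ℝ) :
    piInner π (c • g) h = c * piInner π g h := by
  unfold piInner
  rw [mul_sum]
  exact sum_congr rfl fun x _ => by rw [Pi.smul_apply, smul_eq_mul]; ring

omit [DecidableEq X] in
/-- `⟨g, c•h⟩_π = c⟨g,h⟩_π`. [folklore] -/
private theorem piInner_smul_right (π : X → ℝ) (c : ℝ) (g h : X → ℝ) :
    piInner π g (c • h) = c * piInner π g h := by
  rw [piInner_comm, piInner_smul_left, piInner_comm]

omit [DecidableEq X] in
/-- `⟨g₁ + g₂, h⟩_π = ⟨g₁,h⟩_π + ⟨g₂,h⟩_π`. [folklore] -/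
private theorem piInner_add_left (π g₁ g₂ h : X → ℝ) :
    piInner π (g₁ + g₂) h = piInner π g₁ h + piInner π g₂ h := by
  unfold piInner
  rw [← sum_add_distrib]
  exact sum_congr rfl fun x _ => by rw [Pi.add_apply]; ring

omit [DecidableEq X] in
/-- `⟨g, g⟩_π > 0` for `g ≢ 0` and `π > 0`. [folklore] -/
private theorem piInner_self_pos (hπ : ∀ x, 0 < π x) {g : X → ℝ} (hg : g ≠ 0) :
    0 < piInner π g g := by
  obtain ⟨x₀, hx₀⟩ : ∃ x, g x ≠ 0 := Function.ne_iff.mp hg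
  unfold piInner
  calc (0 : ℝ) < π x₀ * (g x₀ * g x₀) := mul_pos (hπ x₀) (mul_self_pos.mpr hx₀)
    _ ≤ ∑ x, π x * (g x * g x) :=
        single_le_sum (f := fun x => π x * (g x * g x))
          (fun x _ => mul_nonneg (hπ x).le (mul_self_nonneg _)) (mem_univ x₀)

omit [DecidableEq X] in
/-- A real eigenvalue of a row-stochastic matrix has modulus `≤ 1` (maximum principle).
[cite: LevinPeres2017, §12.1 Lemma 12.1 (i)] -/
private theorem abs_le_one_of_eigen (hP : IsRowStochastic P) {f : X → ℝ} {lam : ℝ}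
    (hf : P *ᵥ f = lam • f) (hf0 : f ≠ 0) : |lam| ≤ 1 := by
  obtain ⟨x₁, hx₁⟩ : ∃ x, f x ≠ 0 := Function.ne_iff.mp hf0
  obtain ⟨x, -, hx⟩ := exists_max_image univ (fun x => |f x|) ⟨x₁, mem_univ _⟩
  have hfx : 0 < |f x| := (abs_pos.mpr hx₁).trans_le (hx x₁ (mem_univ _))
  have hPx : (P *ᵥ f) x = lam * f x := by rw [hf, Pi.smul_apply, smul_eq_mul]
  have h1 : |lam| * |f x| ≤ 1 * |f x| := by
    calc |lam| * |f x| = |(P *ᵥ f) x| := by rw [hPx, abs_mul]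
      _ = |∑ y, P x y * f y| := by rw [mulVec_apply₄]
      _ ≤ ∑ y, |P x y * f y| := abs_sum_le_sum_abs _ _
      _ = ∑ y, P x y * |f y| :=
          sum_congr rfl fun y _ => by rw [abs_mul, abs_of_nonneg (hP.1 x y)]
      _ ≤ ∑ y, P x y * |f x| :=
          sum_le_sum fun y _ => mul_le_mul_of_nonneg_left (hx y (mem_univ _)) (hP.1 x y)
      _ = 1 * |f x| := by rw [← sum_mul, hP.2 x]
  exact le_of_mul_le_mul_right h1 hfx

omit [DecidableEq X] in
/-- Eigenfunctions of a reversible `P` with distinct eigenvalues are `π`-orthogonal (`P` is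
self-adjoint on `ℓ²(π)`). [cite: LevinPeres2017, §12.1 Lemma 12.2 (i) and its proof; §22.5 proof of
Lemma 22.18 ("so `f` and `g` correspond to the same eigenvalue")] -/
theorem piInner_eq_zero_of_eigen_ne (hDB : DetailedBalance π P) {f g : X → ℝ} {lam mu : ℝ}
    (hf : P *ᵥ f = lam • f) (hg : P *ᵥ g = mu • g) (hne : lam ≠ mu) : piInner π f g = 0 := by
  have h := piInner_mulVec_comm hDB f g
  rw [hf, hg, piInner_smul_left, piInner_smul_right] at h
  have h2 : (lam - mu) * piInner π f g = 0 := by rw [sub_mul, h, sub_self]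
  rcases mul_eq_zero.mp h2 with h3 | h3
  · exact absurd (sub_eq_zero.mp h3) hne
  · exact h3

omit [DecidableEq X] in
/-- `⟨f, g⟩_π = Σ_j ⟨f, f_j⟩_π ⟨f_j, g⟩_π` (Parseval in the eigenbasis).
[cite: LevinPeres2017, §12.1 proof of Lemma 12.2, eq. (12.4)] -/
theorem piInner_eq_sum_piInner_specFun [DecidableEq X] (hπ : ∀ x, 0 < π x)
    (hA : (symmMatrix π P).IsHermitian) (f g : X → ℝ) :
    piInner π f g = ∑ j, piInner π f (specFun hA j) * piInner π (specFun hA j) g := by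
  unfold piInner
  calc ∑ x, π x * (f x * g x)
      = ∑ x, π x * ((∑ j, piInner π f (specFun hA j) * specFun hA j x) * g x) :=
        sum_congr rfl fun x _ => by rw [sum_piInner_specFun_mul hπ hA f x]
    _ = ∑ x, ∑ j, piInner π f (specFun hA j) * (π x * (specFun hA j x * g x)) :=
        sum_congr rfl fun x _ => by
          rw [sum_mul, mul_sum]
          exact sum_congr rfl fun j _ => by ring
    _ = ∑ j, piInner π f (specFun hA j) * ∑ x, π x * (specFun hA j x * g x) := by
        rw [sum_comm]
        exact sum_congr rfl fun j _ => by rw [mul_sum]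
    _ = ∑ j, piInner π f (specFun hA j) * piInner π (specFun hA j) g := rfl

end Plumbing

/-! ## Increasing functions: the Claim of Lemma 22.17 and the sign of an eigenvalue -/

section Increasing

variable [PartialOrder X] {π : X → ℝ} {P : Matrix X X ℝ}

omit [Fintype X] [DecidableEq X] in
/-- The indicator of an up-set is increasing. [folklore] -/
private theorem monotone_indicator_one {U : Set X} (hU : IsUpperSet U) :
    Monotone (U.indicator fun _ => (1 : ℝ)) := by
  intro y z hyz
  by_cases hy : y ∈ U
  · rw [Set.indicator_of_mem hy, Set.indicator_of_mem (hU hyz hy)]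
  · rw [Set.indicator_of_notMem hy]
    exact Set.indicator_nonneg (fun _ _ => zero_le_one) z

/-- **Claim in the proof of Lemma 22.17** (variant): for `π > 0` and `g ≢ 0` with `E_π g = 0` there is
an increasing `u` with `E_π(u) = 0` and `⟨u, g⟩_π ≠ 0`.  (The book builds `u` from a linear extension
of the order; here: `g(x₀) ≠ 0` and `1{· ≥ x₀} − 1{· > x₀} = 1{x₀}`, so one of the two up-set
indicators pairs non-trivially with `g`; centre it.) [cite: LevinPeres2017, §22.5 proof of Lemma 22.17
("Claim: There is an increasing `f` with `E_π(f) = 0` and `⟨f, f₂⟩_π = 1`")] -/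
theorem exists_monotone_piInner_ne_zero (hπ : ∀ x, 0 < π x) (hπ1 : ∑ x, π x = 1) {g : X → ℝ}
    (hg0 : ∑ x, π x * g x = 0) (hg : g ≠ 0) :
    ∃ u : X → ℝ, Monotone u ∧ ∑ x, π x * u x = 0 ∧ piInner π u g ≠ 0 := by
  obtain ⟨x₀, hx₀⟩ : ∃ x, g x ≠ 0 := Function.ne_iff.mp hg
  set ι₁ : X → ℝ := (Set.Ici x₀).indicator fun _ => 1 with hι₁
  set ι₂ : X → ℝ := (Set.Ioi x₀).indicator fun _ => 1 with hι₂
  have hdiff : ∀ y, ι₁ y - ι₂ y = if y = x₀ then 1 else 0 := by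
    intro y
    by_cases hy : y = x₀
    · subst hy
      simp [hι₁, hι₂]
    · by_cases h1 : x₀ ≤ y
      · have h2 : x₀ < y := lt_of_le_of_ne h1 (Ne.symm hy)
        rw [if_neg hy, hι₁, hι₂, Set.indicator_of_mem (Set.mem_Ici.mpr h1),
          Set.indicator_of_mem (Set.mem_Ioi.mpr h2), sub_self]
      · have h2 : ¬ x₀ < y := fun h => h1 h.le
        rw [if_neg hy, hι₁, hι₂, Set.indicator_of_notMem (by simpa using h1),
          Set.indicator_of_notMem (by simpa using h2), sub_self]
  have hsplit : piInner π ι₁ g - piInner π ι₂ g = π x₀ * g x₀ := by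
    unfold piInner
    rw [← sum_sub_distrib]
    calc ∑ x, (π x * (ι₁ x * g x) - π x * (ι₂ x * g x))
        = ∑ x, (π x * g x) * (ι₁ x - ι₂ x) := sum_congr rfl fun x _ => by ring
      _ = ∑ x, (π x * g x) * (if x = x₀ then 1 else 0) :=
          sum_congr rfl fun x _ => by rw [hdiff]
      _ = π x₀ * g x₀ := by
          simp_rw [mul_ite, mul_one, mul_zero]
          rw [Finset.sum_ite_eq' univ x₀]
          simp
  have hne : π x₀ * g x₀ ≠ 0 := mul_ne_zero (hπ x₀).ne' hx₀
  have hor : piInner π ι₁ g ≠ 0 ∨ piInner π ι₂ g ≠ 0 := by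
    by_contra h
    push Not at h
    rw [h.1, h.2, sub_zero] at hsplit
    exact hne hsplit.symm
  -- centring an increasing `ι` with `⟨ι, g⟩ ≠ 0`
  have build : ∀ ι : X → ℝ, Monotone ι → piInner π ι g ≠ 0 →
      ∃ u : X → ℝ, Monotone u ∧ ∑ x, π x * u x = 0 ∧ piInner π u g ≠ 0 := by
    intro ι hι hιg
    refine ⟨fun x => ι x - ∑ y, π y * ι y, fun a b hab => sub_le_sub_right (hι hab) _, ?_, ?_⟩
    · simp_rw [mul_sub]
      rw [sum_sub_distrib, ← sum_mul, hπ1, one_mul, sub_self]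
    · have h : piInner π (fun x => ι x - ∑ y, π y * ι y) g =
          piInner π ι g - (∑ y, π y * ι y) * ∑ x, π x * g x := by
        unfold piInner
        rw [mul_sum, ← sum_sub_distrib]
        exact sum_congr rfl fun x _ => by ring
      rw [h, hg0, mul_zero, sub_zero]
      exact hιg
  rcases hor with h | h
  · exact build ι₁ (monotone_indicator_one (isUpperSet_Ici x₀)) h
  · exact build ι₂ (monotone_indicator_one (isUpperSet_Ioi x₀)) h

omit [Fintype X] [DecidableEq X] in
/-- "Since `P` is monotone, `Pf = λf` is weakly increasing, so `λ ≥ 0`" — for an increasing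
eigenfunction `f` that separates some comparable pair `x ≤ y`, `f(x) < f(y)`.
[cite: LevinPeres2017, §22.5 proof of Lemma 22.18 (first sentence)] -/
theorem eigenvalue_nonneg_of_monotone [Fintype X] (hmono : ∀ f : X → ℝ, Monotone f → Monotone (P *ᵥ f))
    {f : X → ℝ} (hf : Monotone f) {lam : ℝ} (hPf : P *ᵥ f = lam • f) {x y : X} (hxy : x ≤ y)
    (hfxy : f x < f y) : 0 ≤ lam := by
  have h := hmono f hf hxy
  rw [hPf, Pi.smul_apply, Pi.smul_apply, smul_eq_mul, smul_eq_mul] at h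
  by_contra hneg
  push Not at hneg
  have : lam * f y < lam * f x := mul_lt_mul_of_neg_left hfxy hneg
  linarith

end Increasing

/-! ## Lemma 22.17 -/

section Lemma2217

variable [PartialOrder X] {π : X → ℝ} {P : Matrix X X ℝ}

/-- **Lemma 22.17.**  Suppose `X` carries a partial order and `P` is a reversible (with respect to the
positive probability vector `π`, `|X| ≥ 2`) MONOTONE Markov chain: `Pf` is increasing for every
increasing `f`.  Then the second eigenvalue `λ₂` (`secondEigenvalue π P`) has an increasing
eigenfunction: an increasing `f ≢ 0` with `E_π(f) = 0` and `Pf = λ₂f`.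
[cite: LevinPeres2017, §22.5 Lemma 22.17] -/
theorem LevinPeres2017_lemma_22_17 [Nontrivial X] (hπ : ∀ x, 0 < π x) (hπ1 : ∑ x, π x = 1)
    (hP : IsRowStochastic P) (hDB : DetailedBalance π P)
    (hmono : ∀ f : X → ℝ, Monotone f → Monotone (P *ᵥ f)) :
    ∃ f : X → ℝ, Monotone f ∧ f ≠ 0 ∧ ∑ x, π x * f x = 0 ∧
      P *ᵥ f = secondEigenvalue π P • f := by
  set lam₂ := secondEigenvalue π P with hlam₂def
  have hA := symmMatrix_isHermitian hπ hDB
  have hst : IsStationary π P := hDB.isStationary hP.2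
  -- `λ₂` is attained by some `g ⊥_π 1`, `‖g‖_π = 1`, and bounds every eigenvalue on `1^⊥`
  obtain ⟨g, hg0, hg1, -, hPg⟩ := exists_eigenfunction_spectralGap hπ hπ1 hP hDB
  have hgne : g ≠ 0 := by
    intro h
    rw [h] at hg1
    unfold piInner at hg1
    simp at hg1
  have hle : ∀ lam ∈ orthEigenvalues π P, lam ≤ lam₂ := by
    intro lam hlam
    have h := (isGreatest_orthEigenvalues hπ hπ1 hP hDB).2 hlam
    have h137 := LevinPeres2017_lemma_13_7 hπ hπ1 hP hDB
    unfold spectralGap at h137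
    rw [hlam₂def]
    linarith
  have hlam₂_ge : -1 ≤ lam₂ := by
    have := abs_le_one_of_eigen hP hPg hgne
    rw [abs_le] at this
    exact this.1
  -- the increasing, centred test function `u` with `⟨u, g⟩_π ≠ 0`
  obtain ⟨u, hu, hu0, hug⟩ := exists_monotone_piInner_ne_zero hπ hπ1 hg0 hgne
  -- eigenbasis data
  set φ : X → X → ℝ := specFun hA with hφdef
  set ev : X → ℝ := specVal hA with hevdef
  have hPφ : ∀ j, P *ᵥ φ j = ev j • φ j := fun j => mulVec_specFun hπ hA j
  have hφne : ∀ j, φ j ≠ 0 := by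
    intro j h
    have := piInner_specFun hπ hA j j
    rw [if_pos rfl, ← hφdef, h] at this
    unfold piInner at this
    simp at this
  have hev_ge : ∀ j, -1 ≤ ev j := fun j => by
    have := abs_le_one_of_eigen hP (hPφ j) (hφne j)
    rw [abs_le] at this
    exact this.1
  set a : X → ℝ := fun j => piInner π u (φ j) with hadef
  -- every component of `u` lives on an eigenvalue `≤ λ₂`
  have hev_le : ∀ j, a j ≠ 0 → ev j ≤ lam₂ := by
    intro j hj
    by_cases h1 : ev j = 1
    · -- `φ j` is a non-constant eigenfunction for `1`, so `1 ∈ orthEigenvalues` and `λ₂ = 1`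
      set c := ∑ x, π x * φ j x with hcdef
      have hφ1 : P *ᵥ φ j = φ j := by rw [hPφ j, h1, one_smul]
      by_cases hconst : (fun x => φ j x - c) = 0
      · exfalso
        apply hj
        have hφc : ∀ x, φ j x = c := fun x => by
          have := congr_fun hconst x
          simpa [sub_eq_zero] using this
        show piInner π u (φ j) = 0
        unfold piInner
        simp_rw [hφc]
        calc ∑ x, π x * (u x * c) = c * ∑ x, π x * u x := by
              rw [mul_sum]; exact sum_congr rfl fun x _ => by ring
          _ = 0 := by rw [hu0, mul_zero]
      · have hmem : (1 : ℝ) ∈ orthEigenvalues π P := by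
          refine ⟨fun x => φ j x - c, hconst, ?_, ?_⟩
          · simp_rw [mul_sub]
            rw [sum_sub_distrib, ← sum_mul, hπ1, one_mul, ← hcdef, sub_self]
          · funext x
            rw [one_smul, mulVec_apply₄]
            simp_rw [mul_sub]
            rw [sum_sub_distrib, ← sum_mul, hP.2 x, one_mul, ← mulVec_apply₄, hφ1]
        rw [h1]
        exact hle 1 hmem
    · have hφ0 : ∑ x, π x * φ j x = 0 := sum_mul_eq_zero_of_mulVec_eq_smul hst (hPφ j) h1
      exact hle _ ⟨φ j, hφne j, hφ0, hPφ j⟩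
  -- the shifted power iteration `w_{t+1} = P w_t + 2 w_t`, `w_0 = u`
  let w : ℕ → X → ℝ := fun t => Nat.rec u (fun _ v => P *ᵥ v + (2 : ℝ) • v) t
  have hw0 : w 0 = u := rfl
  have hwsucc : ∀ t, w (t + 1) = P *ᵥ w t + (2 : ℝ) • w t := fun t => rfl
  have hwmono : ∀ t, Monotone (w t) := by
    intro t
    induction t with
    | zero => rw [hw0]; exact hu
    | succ t ih =>
        rw [hwsucc]
        intro x y hxy
        have h1 := hmono _ ih hxy
        have h2 := ih hxy
        simp only [Pi.add_apply, Pi.smul_apply, smul_eq_mul]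
        linarith
  have hwcoef : ∀ t j, piInner π (w t) (φ j) = (ev j + 2) ^ t * a j := by
    intro t j
    induction t with
    | zero => rw [hw0, pow_zero, one_mul]
    | succ t ih =>
        rw [hwsucc, piInner_add_left, piInner_mulVec_comm hDB, hPφ j, piInner_smul_right,
          piInner_smul_left, ih, pow_succ]
        ring
  -- `w_t = Σ_j (λ_j + 2)^t a_j f_j`
  have hwexp : ∀ t x, w t x = ∑ j, (ev j + 2) ^ t * a j * φ j x := by
    intro t x
    rw [← sum_piInner_specFun_mul hπ hA (w t) x]
    exact sum_congr rfl fun j _ => by rw [← hφdef, hwcoef]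
  -- the normalised iterates `h_t = w_t/(λ₂ + 2)^t` and their limit `E`
  set μ₂ : ℝ := lam₂ + 2 with hμ₂def
  have hμ₂pos : 0 < μ₂ := by rw [hμ₂def]; linarith
  let coef : X → ℝ := fun j => if ev j = lam₂ then a j else 0
  let E : X → ℝ := fun x => ∑ j, coef j * φ j x
  have hterm : ∀ j x, Tendsto (fun t : ℕ => ((ev j + 2) / μ₂) ^ t * (a j * φ j x)) atTop
      (𝓝 (coef j * φ j x)) := by
    intro j x
    by_cases hj : ev j = lam₂
    · have hc : coef j = a j := if_pos hj
      have hr : (ev j + 2) / μ₂ = 1 := by rw [hj, hμ₂def, div_self hμ₂pos.ne']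
      rw [hc, hr]
      simp_rw [one_pow, one_mul]
      exact tendsto_const_nhds
    · have hc : coef j = 0 := if_neg hj
      rw [hc, zero_mul]
      by_cases ha : a j = 0
      · simp_rw [ha, zero_mul, mul_zero]
        exact tendsto_const_nhds
      · have hlt : ev j < lam₂ := lt_of_le_of_ne (hev_le j ha) hj
        have hr0 : 0 ≤ (ev j + 2) / μ₂ := div_nonneg (by linarith [hev_ge j]) hμ₂pos.le
        have hr1 : (ev j + 2) / μ₂ < 1 := by
          rw [div_lt_one hμ₂pos, hμ₂def]; linarith
        have h0 := tendsto_pow_atTop_nhds_zero_of_lt_one hr0 hr1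
        rw [show (0 : ℝ) = 0 * (a j * φ j x) by ring]
        exact h0.mul_const _
  have hlim : ∀ x, Tendsto (fun t : ℕ => w t x / μ₂ ^ t) atTop (𝓝 (E x)) := by
    intro x
    have hrw : ∀ t : ℕ, w t x / μ₂ ^ t = ∑ j, ((ev j + 2) / μ₂) ^ t * (a j * φ j x) := by
      intro t
      rw [hwexp, sum_div]
      exact sum_congr rfl fun j _ => by rw [div_pow]; field_simp
    simp_rw [hrw]
    exact tendsto_finsetSum _ fun j _ => hterm j x
  -- `E` is increasing (pointwise limit of increasing functions)
  have hEmono : Monotone E := by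
    intro x y hxy
    refine le_of_tendsto_of_tendsto' (hlim x) (hlim y) fun t => ?_
    exact div_le_div_of_nonneg_right (hwmono t hxy) (pow_pos hμ₂pos t).le
  -- `PE = λ₂ E`
  have hcoef_ev : ∀ j, coef j * ev j = lam₂ * coef j := by
    intro j
    by_cases hj : ev j = lam₂
    · rw [hj, mul_comm]
    · have hc : coef j = 0 := if_neg hj
      rw [hc, zero_mul, mul_zero]
  have hPE : P *ᵥ E = lam₂ • E := by
    funext x
    rw [Pi.smul_apply, smul_eq_mul, mulVec_apply₄]
    calc ∑ y, P x y * E y = ∑ y, ∑ j, coef j * (P x y * φ j y) :=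
          sum_congr rfl fun y _ => by
            show P x y * ∑ j, coef j * φ j y = _
            rw [mul_sum]
            exact sum_congr rfl fun j _ => by ring
      _ = ∑ j, coef j * ∑ y, P x y * φ j y := by
          rw [sum_comm]
          exact sum_congr rfl fun j _ => by rw [mul_sum]
      _ = ∑ j, coef j * (ev j * φ j x) :=
          sum_congr rfl fun j _ => by
            rw [← mulVec_apply₄, hPφ j, Pi.smul_apply, smul_eq_mul]
      _ = ∑ j, lam₂ * (coef j * φ j x) :=
          sum_congr rfl fun j _ => by rw [← mul_assoc, hcoef_ev, mul_assoc]
      _ = lam₂ * E x := by rw [← mul_sum]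
  -- `⟨E, g⟩_π = ⟨u, g⟩_π ≠ 0`
  have hφg : ∀ j, ev j ≠ lam₂ → piInner π (φ j) g = 0 :=
    fun j hj => piInner_eq_zero_of_eigen_ne hDB (hPφ j) hPg hj
  have hEg : piInner π E g = piInner π u g := by
    have hE' : piInner π E g = ∑ j, coef j * piInner π (φ j) g := by
      unfold piInner
      calc ∑ x, π x * (E x * g x) = ∑ x, ∑ j, coef j * (π x * (φ j x * g x)) :=
            sum_congr rfl fun x _ => by
              show π x * ((∑ j, coef j * φ j x) * g x) = _
              rw [sum_mul, mul_sum]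
              exact sum_congr rfl fun j _ => by ring
        _ = ∑ j, coef j * ∑ x, π x * (φ j x * g x) := by
            rw [sum_comm]
            exact sum_congr rfl fun j _ => by rw [mul_sum]
    rw [hE', piInner_eq_sum_piInner_specFun hπ hA u g]
    refine sum_congr rfl fun j _ => ?_
    by_cases hj : ev j = lam₂
    · have hc : coef j = a j := if_pos hj
      rw [hc]
    · have hc : coef j = 0 := if_neg hj
      rw [hc, ← hφdef, hφg j hj, mul_zero, mul_zero]
  -- centre `E` (needed only when `λ₂ = 1`) and conclude
  set cE := ∑ x, π x * E x with hcEdef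
  have hcE : cE = lam₂ * cE := by
    have hcE' : cE = ∑ j, coef j * ∑ x, π x * φ j x := by
      rw [hcEdef]
      calc ∑ x, π x * E x = ∑ x, ∑ j, coef j * (π x * φ j x) :=
            sum_congr rfl fun x _ => by
              show π x * ∑ j, coef j * φ j x = _
              rw [mul_sum]
              exact sum_congr rfl fun j _ => by ring
        _ = ∑ j, coef j * ∑ x, π x * φ j x := by
            rw [sum_comm]
            exact sum_congr rfl fun j _ => by rw [mul_sum]
    rw [hcE', mul_sum]
    refine sum_congr rfl fun j _ => ?_
    by_cases hj : ev j = lam₂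
    · by_cases h1 : lam₂ = 1
      · rw [h1, one_mul]
      · have hφ0 : ∑ x, π x * φ j x = 0 :=
          sum_mul_eq_zero_of_mulVec_eq_smul hst (hPφ j) (by rw [hj]; exact h1)
        rw [hφ0, mul_zero, mul_zero]
    · have hc : coef j = 0 := if_neg hj
      rw [hc, zero_mul, mul_zero]
  refine ⟨fun x => E x - cE, fun x y hxy => sub_le_sub_right (hEmono hxy) _, ?_, ?_, ?_⟩
  · -- non-zero: its inner product with `g` is `⟨u, g⟩_π ≠ 0`
    intro h
    apply hug
    rw [← hEg]
    have h2 : piInner π (fun x => E x - cE) g = piInner π E g - cE * ∑ x, π x * g x := by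
      unfold piInner
      rw [mul_sum, ← sum_sub_distrib]
      exact sum_congr rfl fun x _ => by ring
    rw [h, hg0, mul_zero, sub_zero] at h2
    rw [← h2]
    unfold piInner
    simp
  · simp_rw [mul_sub]
    rw [sum_sub_distrib, ← sum_mul, hπ1, one_mul, ← hcEdef, sub_self]
  · funext x
    rw [Pi.smul_apply, smul_eq_mul, mulVec_apply₄]
    simp_rw [mul_sub]
    rw [sum_sub_distrib, ← sum_mul, hP.2 x, one_mul, ← mulVec_apply₄, hPE, Pi.smul_apply,
      smul_eq_mul]
    nth_rewrite 1 [hcE]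
    ring

end Lemma2217

/-! ## Lemma 22.18 -/

section Lemma2218

variable [PartialOrder X] {π : X → ℝ} {P : Matrix X X ℝ}

/-- **Lemma 22.18.**  Let `P` be a reversible monotone chain (positive reversible probability vector
`π`, `|X| ≥ 2`) whose stationary law has positive correlations — `E_π(φψ) ≥ E_π(φ)E_π(ψ)` for all
increasing `φ, ψ` (in the book: supplied by Theorem 22.16 from "`x` and `y` are comparable if
`P(x,y) > 0`").  If `P` has a strictly increasing eigenfunction `f`, `Pf = λf`, then `f` corresponds
to `λ₂`: `λ = secondEigenvalue π P`. [cite: LevinPeres2017, §22.5 Lemma 22.18] -/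
theorem LevinPeres2017_lemma_22_18 [Nontrivial X] (hπ : ∀ x, 0 < π x) (hπ1 : ∑ x, π x = 1)
    (hP : IsRowStochastic P) (hDB : DetailedBalance π P)
    (hmono : ∀ f : X → ℝ, Monotone f → Monotone (P *ᵥ f))
    (hpc : ∀ φ ψ : X → ℝ, Monotone φ → Monotone ψ →
      (∑ x, π x * φ x) * (∑ x, π x * ψ x) ≤ ∑ x, π x * (φ x * ψ x))
    {f : X → ℝ} (hf : StrictMono f) {lam : ℝ} (hPf : P *ᵥ f = lam • f) :
    lam = secondEigenvalue π P := by
  classical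
  obtain ⟨g, hg, hgne, hg0, hPg⟩ := LevinPeres2017_lemma_22_17 hπ hπ1 hP hDB hmono
  -- a small `ε > 0` with `f − εg` increasing
  let S : Finset ℝ :=
    ((univ : Finset (X × X)).filter fun p => p.1 < p.2).image fun p => f p.2 - f p.1
  set M : ℝ := ∑ x, |g x| with hMdef
  have hM0 : 0 ≤ M := sum_nonneg fun x _ => abs_nonneg _
  have hgdiff : ∀ x y, g y - g x ≤ 2 * M := by
    intro x y
    have hx : |g x| ≤ M := single_le_sum (f := fun x => |g x|) (fun x _ => abs_nonneg _) (mem_univ x)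
    have hy : |g y| ≤ M := single_le_sum (f := fun x => |g x|) (fun x _ => abs_nonneg _) (mem_univ y)
    have h1 := le_abs_self (g y)
    have h2 := neg_abs_le (g x)
    linarith
  obtain ⟨ε, hεpos, hεmono⟩ : ∃ ε : ℝ, 0 < ε ∧ Monotone fun x => f x - ε * g x := by
    by_cases hS : S.Nonempty
    · set δ := S.min' hS with hδdef
      have hδpos : 0 < δ := by
        obtain ⟨p, hp, hpδ⟩ := mem_image.mp (S.min'_mem hS)
        rw [mem_filter] at hp
        rw [hδdef, ← hpδ]
        exact sub_pos.mpr (hf hp.2)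
      have hδle : ∀ x y, x < y → δ ≤ f y - f x := fun x y hxy =>
        S.min'_le _ (mem_image.mpr ⟨(x, y), mem_filter.mpr ⟨mem_univ _, hxy⟩, rfl⟩)
      refine ⟨δ / (2 * M + 1), div_pos hδpos (by linarith), fun x y hxy => ?_⟩
      rcases hxy.lt_or_eq with hlt | heq
      · have h1 := hδle x y hlt
        have h2 := hgdiff x y
        have h3 : δ / (2 * M + 1) * (g y - g x) ≤ δ := by
          calc δ / (2 * M + 1) * (g y - g x) ≤ δ / (2 * M + 1) * (2 * M + 1) := by
                apply mul_le_mul_of_nonneg_left (by linarith) (div_pos hδpos (by linarith)).le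
            _ = δ := div_mul_cancel₀ δ (by linarith)
        show f x - δ / (2 * M + 1) * g x ≤ f y - δ / (2 * M + 1) * g y
        nlinarith
      · rw [heq]
    · refine ⟨1, one_pos, fun x y hxy => ?_⟩
      rcases hxy.lt_or_eq with hlt | heq
      · exact absurd ⟨f y - f x, mem_image.mpr ⟨(x, y), mem_filter.mpr ⟨mem_univ _, hlt⟩, rfl⟩⟩ hS
      · rw [heq]
  -- positive correlations applied to `f − εg` and `g`
  have hcorr := hpc (fun x => f x - ε * g x) g hεmono hg
  rw [hg0, mul_zero] at hcorr
  have hsplit : ∑ x, π x * ((f x - ε * g x) * g x) = piInner π f g - ε * piInner π g g := by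
    unfold piInner
    rw [mul_sum, ← sum_sub_distrib]
    exact sum_congr rfl fun x _ => by ring
  rw [hsplit] at hcorr
  have hgg : 0 < piInner π g g := piInner_self_pos hπ hgne
  have hfg : 0 < piInner π f g := by nlinarith
  -- orthogonality forces `λ = λ₂`
  by_contra hne
  have := piInner_eq_zero_of_eigen_ne hDB hPf hPg hne
  linarith

end Lemma2218

end Literature.Probability.MarkovChains
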